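import Summits.BirchSwinnertonDyer.BirchSwinnertonDyer.Theorems.PrintCf2RamifiedOffTYZRankZeroDigitWang
import Summits.BirchSwinnertonDyer.BirchSwinnertonDyer.Theorems.PrintCf2RamifiedOffTYZLevelTwoTwoPrimes
import HarnessLib

/-!
# DEPTH TWO on the two-prime sector: the rank-zero digit decides whether the prime's Heegner class enters `P(lm) mod 4A(ℍ′_{lm})`
# (crux stmt-BirchSwinnertonDyer-20509 `RamifiedOffTYZOfFacts`, line `offtyz-v7`, LEAD cruxlead-20509 g25, cycle 26; `def`-free, no `sorry`)

HONEST FRAMING (cell `bsd-print-cf2`, route `PrintCf2`; `--supports stmt-BirchSwinnertonDyer-20509`).  BSD is not proved by any of this; no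
class is closed by this file; item 23431 (C⁺) and crux 20509 stay OPEN.

Sequel of `PrintCf2RamifiedOffTYZRankZeroDigit{,Wang}` (this seat) and of g10's `PrintCf2RamifiedOffTYZLevelTwoTwoPrimes` (cycle 11).  On the
two-prime sector `n = lm` (`l ≡ 1`, `m ≡ 5, 7 (mod 8)` primes; Legendre types R1/R2 of the census) g10 proved, from the displayed recursion and
Thm 3.5 at `m` (`h35m : 2·P(m) − (u·𝓛(m))·α_m` torsion), the EXACT congruence `P(lm) ≡ Z(lm) − c·α_m (mod tors)`, `c = ±(𝓛(l)/2)·u·𝓛(m)`, and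
read it at LAYER 1 (`mod 2A + tors`), where — since `α_m ∈ 2A(ℍ′) + tors` (§2: `u·𝓛(m)` is odd) — the bit `𝓛(l)/2 mod 2` is INVISIBLE:
`[P(lm)] = [Z(lm)]` in both of g10's cases.  The bit lives one digit down, and there it is exactly the rank-zero digit made exact by this seat:

* §1 (abstract, any abelian group): if `x ≡ z − c·a (mod tors)` and `a ∈ 2G + tors`, then `x ∈ 4G + tors ⟺ z ∈ 4G + tors` for `c` EVEN and
  `x ∈ 4G + tors ⟺ z − a ∈ 4G + tors` for `c` ODD (`fourDivisible_iff_of_even/_odd_of_twoDivisible`).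
* §2 `twoDivisible_of_h35m`: `2·P(m) − (u·𝓛(m))·α_m` torsion with `u = ±1`, `𝓛(m)` odd ⟹ `α_m ∈ 2A(ℍ′) + tors` (the double of the prime's
  Heegner point `P(m) = Z(m)` up to torsion; `[α_m] = 0` at layer 1).
* §3 ★ `fourDivisible_genusPoint_iff_of_four_dvd` — `4 ∣ 𝓛(l)` ⟹ **`P(lm) ∈ 4A + tors ⟺ Z(lm) ∈ 4A + tors`**;
  ★ `fourDivisible_genusPoint_iff_of_not_four_dvd` — `𝓛(l)/2` odd ⟹ **`P(lm) ∈ 4A + tors ⟺ Z(lm) − α_m ∈ 4A + tors`**: at depth two the prime's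
  class `α_m` ENTERS exactly when the rank-zero digit of `l` is on; `genusPoint_eq_genusPeriod_of_scriptL_eq_zero` — `𝓛(l) = 0 ⟹ P(lm) = Z(lm)`.
* §4 ★★ BY NAME INSIDE 𝔅_ram (conjuncts 2, 4; `RankZeroDigit.prime_one_mod_eight_digit_of_facts`): with `r_an(E_l) = 0` the case is decided by
  **`#Sel₄(E_l)`** — `≠ 2⁴`: `P(lm) ∈ 4A + tors ⟺ Z(lm) ∈ 4A + tors`; `= 2⁴`: `P(lm) ∈ 4A + tors ⟺ Z(lm) − α_m ∈ 4A + tors`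
  (`fourDivisible_genusPoint_dichotomy_of_facts`); with `r_an(E_l) ≥ 2`: `P(lm) = Z(lm)` (`genusPoint_eq_genusPeriod_of_two_le_analyticRank`).
* §5 ★★ WITH WANG 2016 (`RankZeroDigit.not_four_dvd_scriptL_iff_isDeltaOne_of_facts`): decided by **`IsDeltaOne l`** (`l = u² + 8v²`, `v` odd):
  `fourDivisible_genusPoint_dichotomy_of_wang`.

READING.  On the invisible special stratum of R2 the lineage proved «C⁺ ⟺ P(n) ∈ 2A + tors ∧ P(n) ∉ 4A + tors» (g18
`InvisibleGenerator.levelTwo_iff_depth_genusPoint_eq_one_of_X_eq_two_mul_sq`); by §4 the second clause is «`Z(lm) ∉ 4A + tors`» on the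
`#Sel₄(E_l) ≠ 2⁴` rows and «`Z(lm) − α_m ∉ 4A + tors`» on the `#Sel₄(E_l) = 2⁴` rows — the `4`-Selmer group of the RANK-ZERO factor `E_l` enters the
statement of C⁺ on the composite `lm`, by name.  (The class of `Z(lm)` itself at depth two remains the beyond-print object of the line.)

References: [cite: TianYuanZhang2017, §3.1 (p0011 L67–L73), Thm. 3.5 (p0011 L94–L100), §1 (1.1)]; [cite: BurungaleFlach2024, Thm 1.1 / Cor. 3];
[cite: Wang2016CongruentSha, Thm. 3 and Lemma 4]; [cite: HeathBrown1994SelmerCongruentII, Appendix (Monsky)]; tree: `…LevelTwoTwoPrimes`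
(`genusPoint_two_primes_congr`, `P_eq_of_two_primes`, `odd_coeff_iff`, `twoPowDivisible_iff_of_sub_isOfFinAddOrder`), `…RankZeroDigit{,Wang}`.
LEAD memo: `Lines/offtyz_v7_RankZeroDigit.md`.
-/

noncomputable section

open scoped Classical

open WeierstrassCurve Literature.NumberTheory.EllipticCurves Literature.NumberTheory.EllipticCurves.TianYuanZhang2017
  Literature.NumberTheory.EllipticCurves.Wang2016 Summit.BirchSwinnertonDyer.PrintCf2.LevelTwoTwoPrimes

set_option autoImplicit false

namespace Summit.BirchSwinnertonDyer.PrintCf2.RankZeroDigitDepthTwo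

/-! ## §1 Abstract bookkeeping at depth two -/

section Abstract

variable {G : Type*} [AddCommGroup G]

/-- Shifting the `4`-divisibility witness by a fixed point: `z − 4·w ∈ 4G + tors ⟺ z ∈ 4G + tors`. [folklore] -/
theorem fourDivisible_sub_four_smul_iff (z w : G) :
    (∃ y : G, IsOfFinAddOrder (z - (4 : ℤ) • w - (4 : ℤ) • y)) ↔ ∃ y : G, IsOfFinAddOrder (z - (4 : ℤ) • y) := by
  constructor
  · rintro ⟨y, hy⟩
    refine ⟨y + w, ?_⟩
    have e : z - (4 : ℤ) • (y + w) = z - (4 : ℤ) • w - (4 : ℤ) • y := by module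
    rwa [e]
  · rintro ⟨y, hy⟩
    refine ⟨y - w, ?_⟩
    have e : z - (4 : ℤ) • w - (4 : ℤ) • (y - w) = z - (4 : ℤ) • y := by module
    rwa [e]

/-- `x ≡ z − c·a (mod tors)`, `c` EVEN, `a ∈ 2G + tors` ⟹ (`x ∈ 4G + tors ⟺ z ∈ 4G + tors`): an even multiple of a `2`-divisible class
is `4`-divisible. [folklore] -/
theorem fourDivisible_iff_of_even_of_twoDivisible {x z a : G} {c : ℤ} (hc : Even c)
    (ha : ∃ b : G, IsOfFinAddOrder (a - (2 : ℤ) • b)) (h : IsOfFinAddOrder (x - (z - c • a))) :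
    (∃ y : G, IsOfFinAddOrder (x - (4 : ℤ) • y)) ↔ ∃ y : G, IsOfFinAddOrder (z - (4 : ℤ) • y) := by
  obtain ⟨j, rfl⟩ := hc
  obtain ⟨b, hb⟩ := ha
  -- `x − (z − 4·(j·b))` is torsion
  have h' : IsOfFinAddOrder (x - (z - (4 : ℤ) • (j • b))) := by
    have e : x - (z - (4 : ℤ) • (j • b)) = (x - (z - (j + j) • a)) + -((j + j) • (a - (2 : ℤ) • b)) := by module
    rw [e]
    exact h.add hb.zsmul.neg
  have h4 := twoPowDivisible_iff_of_sub_isOfFinAddOrder h' 2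
  rw [show ((2 : ℤ) ^ 2) = 4 by norm_num] at h4
  rw [h4, ← fourDivisible_sub_four_smul_iff z (j • b)]

/-- `x ≡ z − c·a (mod tors)`, `c` ODD, `a ∈ 2G + tors` ⟹ (`x ∈ 4G + tors ⟺ z − a ∈ 4G + tors`): modulo `4G + tors` an odd multiple of a
`2`-divisible class is the class itself. [folklore] -/
theorem fourDivisible_iff_of_odd_of_twoDivisible {x z a : G} {c : ℤ} (hc : Odd c)
    (ha : ∃ b : G, IsOfFinAddOrder (a - (2 : ℤ) • b)) (h : IsOfFinAddOrder (x - (z - c • a))) :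
    (∃ y : G, IsOfFinAddOrder (x - (4 : ℤ) • y)) ↔ ∃ y : G, IsOfFinAddOrder (z - a - (4 : ℤ) • y) := by
  obtain ⟨j, rfl⟩ := hc
  obtain ⟨b, hb⟩ := ha
  -- `x − (z − a − 4·(j·b))` is torsion
  have h' : IsOfFinAddOrder (x - (z - a - (4 : ℤ) • (j • b))) := by
    have e : x - (z - a - (4 : ℤ) • (j • b)) = (x - (z - (2 * j + 1) • a)) + -((j + j) • (a - (2 : ℤ) • b)) := by module
    rw [e]
    exact h.add hb.zsmul.neg
  have h4 := twoPowDivisible_iff_of_sub_isOfFinAddOrder h' 2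
  rw [show ((2 : ℤ) ^ 2) = 4 by norm_num] at h4
  rw [h4, ← fourDivisible_sub_four_smul_iff (z - a) (j • b)]

end Abstract

/-! ## §2 `α_m ∈ 2A(ℍ′) + tors` from Thm 3.5 at the prime `m` -/

section Prime

variable {n : ℕ}

/-- **`α_m` is `2`-divisible modulo torsion in `A(ℍ′)`**: if `2·P(m) − (u·𝓛(m))·α_m` has finite order with `u = ±1` and `𝓛(m)` odd (Thm 3.5's
main clause at a prime `m ≡ 5, 7 (mod 8)`, where `ρ(m) = 0` and `𝓛(m)` is odd), then `α_m − 2·b` has finite order for some `b ∈ A(ℍ′)` —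
`α_m` is twice the Heegner point `P(m)` up to torsion and an odd multiple. [cite: TianYuanZhang2017, Thm. 3.5 (p0011 L94–L100), Thm. 1.2] -/
theorem twoDivisible_of_h35m (D : GenusPointData n) {m : ℕ} {αm : APoint D.H} {u : ℤ} (hu : u = 1 ∨ u = -1)
    (hLm : Odd (D.scriptL m)) (h35m : IsOfFinAddOrder ((2 : ℤ) • D.P m - (u * D.scriptL m) • αm)) :
    ∃ b : APoint D.H, IsOfFinAddOrder (αm - (2 : ℤ) • b) := by
  have hodd : Odd (u * D.scriptL m) := by
    rcases hu with rfl | rfl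
    · simpa using hLm
    · simpa using hLm.neg
  obtain ⟨j, hj⟩ := hodd
  refine ⟨D.P m - j • αm, ?_⟩
  have e : αm - (2 : ℤ) • (D.P m - j • αm) = -((2 : ℤ) • D.P m - (u * D.scriptL m) • αm) := by
    rw [hj]
    module
  rw [e]
  exact h35m.neg

end Prime

/-! ## §3 Depth two on the two-prime sector -/

section TwoPrimes

variable {n : ℕ}

/-- ★ **`4 ∣ 𝓛(l)` ⟹ `P(lm) ∈ 4A(ℍ′) + tors ⟺ Z(lm) ∈ 4A(ℍ′) + tors`.**  Primes `l ≡ 1`, `m ≡ 5` or `7 (mod 8)`, `n = lm`; data `D` with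
the displayed recursion and `ε`-types; `4 ∣ 𝓛(l)`; Thm 3.5 at `m` in `ℍ′_n` (`h35m`, `u = ±1`, `𝓛(m)` odd).  Then the genus point and the genus
period of `lm` have the same depth-two class. [cite: TianYuanZhang2017, §3.1 (p0011 L67–L73), Thm. 3.5 (p0011 L94–L100)] -/
theorem fourDivisible_genusPoint_iff_of_four_dvd {l m : ℕ} (hl : l.Prime) (hm : m.Prime) (hl8 : l % 8 = 1)
    (hm8 : m % 8 = 5 ∨ m % 8 = 7) (hn : n = l * m) (D : GenusPointData n) (hrec : D.recursion) (heps : D.epsSpec)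
    (h4 : (4 : ℤ) ∣ D.scriptL l) (hLm : Odd (D.scriptL m)) {αm : APoint D.H} {u : ℤ} (hu : u = 1 ∨ u = -1)
    (h35m : IsOfFinAddOrder ((2 : ℤ) • D.P m - (u * D.scriptL m) • αm)) :
    (∃ y : APoint D.H, IsOfFinAddOrder (D.P n - (4 : ℤ) • y)) ↔
      ∃ y : APoint D.H, IsOfFinAddOrder (D.Z n - (4 : ℤ) • y) := by
  obtain ⟨c'', hc''⟩ := h4
  have hLl : D.scriptL l = 2 * (2 * c'') := by rw [hc'']; ring
  obtain ⟨s, -, h⟩ := genusPoint_two_primes_congr hl hm hl8 hm8 hn D hrec heps hLl h35m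
  have hev : Even (s * (2 * c'') * (u * D.scriptL m)) := ⟨s * c'' * (u * D.scriptL m), by ring⟩
  exact fourDivisible_iff_of_even_of_twoDivisible hev (twoDivisible_of_h35m D hu hLm h35m) h

/-- ★ **`𝓛(l)/2` odd ⟹ `P(lm) ∈ 4A(ℍ′) + tors ⟺ Z(lm) − α_m ∈ 4A(ℍ′) + tors`.**  Same sector and data, `𝓛(l) = 2c′` with `c′` odd: at depth two
the class `α_m` of the prime twist (twice its Heegner point) ENTERS the class of the genus point of `lm`.
[cite: TianYuanZhang2017, §3.1 (p0011 L67–L73), Thm. 3.5 (p0011 L94–L100), Thm. 1.2] -/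
theorem fourDivisible_genusPoint_iff_of_not_four_dvd {l m : ℕ} (hl : l.Prime) (hm : m.Prime) (hl8 : l % 8 = 1)
    (hm8 : m % 8 = 5 ∨ m % 8 = 7) (hn : n = l * m) (D : GenusPointData n) (hrec : D.recursion) (heps : D.epsSpec)
    {c' : ℤ} (hLl : D.scriptL l = 2 * c') (hc' : Odd c') (hLm : Odd (D.scriptL m)) {αm : APoint D.H} {u : ℤ}
    (hu : u = 1 ∨ u = -1) (h35m : IsOfFinAddOrder ((2 : ℤ) • D.P m - (u * D.scriptL m) • αm)) :
    (∃ y : APoint D.H, IsOfFinAddOrder (D.P n - (4 : ℤ) • y)) ↔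
      ∃ y : APoint D.H, IsOfFinAddOrder (D.Z n - αm - (4 : ℤ) • y) := by
  obtain ⟨s, hs, h⟩ := genusPoint_two_primes_congr hl hm hl8 hm8 hn D hrec heps hLl h35m
  exact fourDivisible_iff_of_odd_of_twoDivisible ((odd_coeff_iff hs hu hLm).mpr hc') (twoDivisible_of_h35m D hu hLm h35m) h

/-- `𝓛(l) = 0` (the prime `l` is congruent, `L(E_l, 1) = 0`) ⟹ **`P(lm) = Z(lm)`** exactly. [cite: TianYuanZhang2017, §3.1 (p0011 L67–L73)] -/
theorem genusPoint_eq_genusPeriod_of_scriptL_eq_zero {l m : ℕ} (hl : l.Prime) (hm : m.Prime) (hl8 : l % 8 = 1)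
    (hm8 : m % 8 = 5 ∨ m % 8 = 7) (hn : n = l * m) (D : GenusPointData n) (hrec : D.recursion) (heps : D.epsSpec)
    (h0 : D.scriptL l = 0) : D.P n = D.Z n := by
  obtain ⟨-, s, -, hP⟩ := P_eq_of_two_primes hl hm hl8 hm8 hn D hrec heps
  rw [hP, h0, zero_smul, smul_zero, sub_zero]

end TwoPrimes

/-! ## §4 By name inside 𝔅_ram: the `4`-Selmer group of the rank-zero factor decides -/

section Bundle

variable {n : ℕ}

/-- The sign choice `D.scriptL l` of the data is an `L` with `𝓛(l)² = L²` (`scriptLSpec` at the divisor `l` of `n = lm`, `l > 1`).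
[cite: TianYuanZhang2017, §3.1 (p0011 L73)] -/
theorem isScriptL_scriptL_left {l m : ℕ} (hl : l.Prime) (hm : m.Prime) (hn : n = l * m) (D : GenusPointData n)
    (hLs : D.scriptLSpec) : IsScriptL l (D.scriptL l) :=
  hLs l (Nat.mem_divisors.mpr ⟨hn ▸ Dvd.intro m rfl, hn ▸ Nat.mul_ne_zero hl.ne_zero hm.ne_zero⟩) hl.one_lt

/-- ★★ **THE DEPTH-TWO DICHOTOMY BY NAME, inside 𝔅_ram.**  Granted conjuncts 2 (modularity) and 4 (CM rank-zero BSD) of the bundle: on the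
two-prime sector (`l ≡ 1`, `m ≡ 5, 7 (mod 8)` primes, `n = lm`; data with the displayed recursion, `ε`-types, integrality; Thm 3.5 at `m` with
`u = ±1` and `𝓛(m)` odd) with `ord_{s=1} L(E_l, s) = 0`:
if `#Sel₄(E_l) ≠ 2⁴` then `P(lm) ∈ 4A + tors ⟺ Z(lm) ∈ 4A + tors`; if `#Sel₄(E_l) = 2⁴` then `P(lm) ∈ 4A + tors ⟺ Z(lm) − α_m ∈ 4A + tors`.
[cite: TianYuanZhang2017, §3.1, Thm. 3.5, §1 (1.1)] [cite: BurungaleFlach2024, Thm 1.1 / Cor. 3] [cite: HeathBrown1994SelmerCongruentII, Appendix (Monsky)] -/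
theorem fourDivisible_genusPoint_dichotomy_of_facts (hmod : WeierstrassCurve.hasEntireLFunction_rat)
    (hCM0 : bsdTriple_of_hasCM_of_L_one_ne_zero) {l m : ℕ} (hl : l.Prime) (hm : m.Prime) (hl8 : l % 8 = 1)
    (hm8 : m % 8 = 5 ∨ m % 8 = 7) (hn : n = l * m) (h0 : (congruentNumberCurve l).analyticRank = 0)
    (D : GenusPointData n) (hLs : D.scriptLSpec) (hrec : D.recursion) (heps : D.epsSpec)
    (hLm : Odd (D.scriptL m)) {αm : APoint D.H} {u : ℤ} (hu : u = 1 ∨ u = -1)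
    (h35m : IsOfFinAddOrder ((2 : ℤ) • D.P m - (u * D.scriptL m) • αm)) :
    (Nat.card ((congruentNumberCurve l).selmerGroup 4) ≠ 2 ^ 4 →
      ((∃ y : APoint D.H, IsOfFinAddOrder (D.P n - (4 : ℤ) • y)) ↔ ∃ y : APoint D.H, IsOfFinAddOrder (D.Z n - (4 : ℤ) • y))) ∧
    (Nat.card ((congruentNumberCurve l).selmerGroup 4) = 2 ^ 4 →
      ((∃ y : APoint D.H, IsOfFinAddOrder (D.P n - (4 : ℤ) • y)) ↔
        ∃ y : APoint D.H, IsOfFinAddOrder (D.Z n - αm - (4 : ℤ) • y))) := by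
  obtain ⟨hL0, h2, hiff⟩ := RankZeroDigit.prime_one_mod_eight_digit_of_facts hmod hCM0 hl hl8 h0
    (isScriptL_scriptL_left hl hm hn D hLs)
  constructor
  · intro hS₄
    exact fourDivisible_genusPoint_iff_of_four_dvd hl hm hl8 hm8 hn D hrec heps (hiff.mpr hS₄) hLm hu h35m
  · intro hS₄
    obtain ⟨c', hc'⟩ := h2
    have hodd : Odd c' := by
      refine Int.not_even_iff_odd.mp ?_
      rintro ⟨j, rfl⟩
      exact (hiff.mp ⟨j, by rw [hc']; ring⟩) hS₄
    exact fourDivisible_genusPoint_iff_of_not_four_dvd hl hm hl8 hm8 hn D hrec heps (c' := c') (by rw [hc']) hodd hLm hu h35m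

/-- **`r_an(E_l) ≥ 2` ⟹ `P(lm) = Z(lm)`** (fact-free: `𝓛(l) = 0` by the third case of its definition). [cite: TianYuanZhang2017, §1, §3.1] -/
theorem genusPoint_eq_genusPeriod_of_two_le_analyticRank {l m : ℕ} (hl : l.Prime) (hm : m.Prime) (hl8 : l % 8 = 1)
    (hm8 : m % 8 = 5 ∨ m % 8 = 7) (hn : n = l * m) (h2 : 2 ≤ (congruentNumberCurve l).analyticRank)
    (D : GenusPointData n) (hLs : D.scriptLSpec) (hrec : D.recursion) (heps : D.epsSpec) : D.P n = D.Z n :=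
  genusPoint_eq_genusPeriod_of_scriptL_eq_zero hl hm hl8 hm8 hn D hrec heps
    (RankZeroDigit.scriptL_eq_zero_of_two_le_analyticRank h2 (isScriptL_scriptL_left hl hm hn D hLs))

end Bundle

/-! ## §5 With Wang 2016: the representation `l = u² + 8v²` decides -/

section Wang

variable {n : ℕ}

/-- ★★ **THE DEPTH-TWO DICHOTOMY BY `l = u² + 8v²`.**  Granted conjuncts 2, 4 of 𝔅_ram and Wang 2016 Thm 3 + Lemma 4: on the two-prime sector
with `r_an(E_l) = 0`: if `l = u² + 8v²` with `v` odd (`IsDeltaOne l`) then `P(lm) ∈ 4A + tors ⟺ Z(lm) − α_m ∈ 4A + tors`; otherwise (for a prime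
`l ≡ 1 (mod 8)`: `l = x² + 32y²`) `P(lm) ∈ 4A + tors ⟺ Z(lm) ∈ 4A + tors`.
[cite: Wang2016CongruentSha, Thm. 3 and Lemma 4] [cite: TianYuanZhang2017, §3.1, Thm. 3.5] [cite: BurungaleFlach2024, Thm 1.1 / Cor. 3] -/
theorem fourDivisible_genusPoint_dichotomy_of_wang (hmod : WeierstrassCurve.hasEntireLFunction_rat)
    (hCM0 : bsdTriple_of_hasCM_of_L_one_ne_zero) (h3 : thm3_rank_zero_and_sha_two_by_two)
    (hL4 : lem4_card_selmerGroup_two_eq_sixteen_iff_h4) {l m : ℕ} (hl : l.Prime) (hm : m.Prime) (hl8 : l % 8 = 1)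
    (hm8 : m % 8 = 5 ∨ m % 8 = 7) (hn : n = l * m) (h0 : (congruentNumberCurve l).analyticRank = 0)
    (D : GenusPointData n) (hLs : D.scriptLSpec) (hrec : D.recursion) (heps : D.epsSpec)
    (hLm : Odd (D.scriptL m)) {αm : APoint D.H} {u : ℤ} (hu : u = 1 ∨ u = -1)
    (h35m : IsOfFinAddOrder ((2 : ℤ) • D.P m - (u * D.scriptL m) • αm)) :
    (IsDeltaOne l →
      ((∃ y : APoint D.H, IsOfFinAddOrder (D.P n - (4 : ℤ) • y)) ↔
        ∃ y : APoint D.H, IsOfFinAddOrder (D.Z n - αm - (4 : ℤ) • y))) ∧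
    (¬ IsDeltaOne l →
      ((∃ y : APoint D.H, IsOfFinAddOrder (D.P n - (4 : ℤ) • y)) ↔ ∃ y : APoint D.H, IsOfFinAddOrder (D.Z n - (4 : ℤ) • y))) := by
  have hL := isScriptL_scriptL_left hl hm hn D hLs
  have hδ := RankZeroDigit.not_four_dvd_scriptL_iff_isDeltaOne_of_facts hmod hCM0 h3 hL4 hl hl8 h0 hL
  obtain ⟨-, h2, hiff⟩ := RankZeroDigit.prime_one_mod_eight_digit_of_facts hmod hCM0 hl hl8 h0 hL
  obtain ⟨hne, heq⟩ := fourDivisible_genusPoint_dichotomy_of_facts hmod hCM0 hl hm hl8 hm8 hn h0 D hLs hrec heps hLm hu h35m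
  constructor
  · intro hδ1
    exact heq (by by_contra hS₄; exact (hδ.mpr hδ1) (hiff.mpr hS₄))
  · intro hδ0
    exact hne (hiff.mp (by by_contra h4; exact hδ0 (hδ.mp h4)))

end Wang

end Summit.BirchSwinnertonDyer.PrintCf2.RankZeroDigitDepthTwo

end
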